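import Summits.ABC.ABC.Theorems.TwistAmplificationSharpModerateLawDeepRegimeCalibrationLemmas
import Summits.ABC.ABC.Theorems.TwistAmplificationSharpModerateLawCuspDispersionDefs

/-!
# Crux `TwistAmplification.SharpModerateLaw` (stmt-ABC-1975), line `deep-moduli-cusp-dispersion`:
invariants of the twisted Frey pairs (summit calibration `deep-regime law ⇒ ABC`, piece a1)

The summit calibration of the line's hardest stub `stub_deepRegime` injects into the twist-aware deep
regime the TWISTED Frey pairs

  `x(a,b,d) = (d²·c₄, d³·c₆)`, `(c₄, c₆) = freyPair a b = (16(a²+ab+b²), −32(b−a)(2a+b)(a+2b))`,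

of a coprime pair `(a, b)` of distinct positive integers and a twisting parameter `d` which is `1` or a
prime not dividing `m = ab(a+b)`.  This file proves the registered sub-goal `twistedFreyPair_facts`:
every invariant of `x(a,b,d)` the counting worker needs, namely (with `A = a²+ab+b²`)

* `x.1 = 16A·d² > 0`, `x.2 ≠ 0`, `x.1³ − x.2² = 27648·m²·d⁶ ≠ 0`, `1728 ∣ x.1³ − x.2²`,
  `x.1³ = (16A)³d⁶`;
* tower-freeness `TF x` (`two_pow_dvd_twist_fst`, `odd_prime_not_dvd_twist`, `twistPrime_not_dvd`:
  an odd prime `p` with `p² ∣ 16A`, `p ∣ c₆` does not exist, and `v₂(x.1) = 4`);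
* the conductor proxy `N*(x) ≤ 2·rad(m)·d²` (`nstar_twist_le`: the primes of `Δ = 16m²d⁶` are those of
  `m` and `d`; an odd prime of `m` does not divide `x.1`, `2` is charged `≤ 2·2`, `d` is charged `≤ d²`);
* the simple radical `r'(x) = 1` (`simpleRad_twist_eq_one`: every prime of `2¹⁰3³m²d⁶` divides it squared);
* the size inequalities `1728(a+b)⁶ ≤ (16A)³ < 4096(a+b)⁶`, `16m² ≤ (16A)³`;
* the twist divisors: `d'² ∣ x.1 ∧ d'³ ∣ x.2 ⇒ d' ∣ 4d` (`twistDiv_dvd`, prime by prime).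
-/

noncomputable section

set_option linter.dupNamespace false

namespace Summit.ABC.ABC.Theorems.SharpModerateLaw.CuspDispersion

open Literature.NumberTheory.DiophantineGeometry (rad)

variable {a b d : ℕ}

/-! ## 1. Local facts: which prime powers divide `d²·16A` and `d³·c₆` -/

/-- For `gcd(a,b) = 1` no odd prime `p` has `p² ∣ 16A` and `p ∣ c₆`: for `p = 3` this would give
`9 ∣ A` (`nine_not_dvd_freyA`), for `p ≠ 3` it would give `p ∣ A` and `p ∣ (b−a)(2a+b)(a+2b)`
(`not_dvd_freyA_of_dvd_P`). -/
theorem odd_prime_sq_dvd_c4_dvd_c6 (hab : Nat.Coprime a b) {p : ℕ} (hp : p.Prime) (hp2 : p ≠ 2)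
    (h1 : (p : ℤ) ^ 2 ∣ 16 * freyA a b) (h2 : (p : ℤ) ∣ (freyPair a b).2) : False := by
  have hp' : Prime (p : ℤ) := Nat.prime_iff_prime_int.mp hp
  have hp2' : ¬ (p : ℤ) ∣ 2 := by
    intro h
    have h' : p ∣ 2 := by exact_mod_cast h
    exact hp2 ((Nat.prime_dvd_prime_iff_eq hp Nat.prime_two).mp h')
  by_cases hp3 : p = 3
  · apply nine_not_dvd_freyA hab
    have h9 : (9 : ℤ) ∣ 16 * freyA a b := by
      have e : (p : ℤ) ^ 2 = 9 := by rw [hp3]; norm_num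
      rw [e] at h1
      exact h1
    exact (Int.isCoprime_iff_gcd_eq_one.mpr (by norm_num) : IsCoprime (9 : ℤ) 16).dvd_of_dvd_mul_left h9
  · have hpA : (p : ℤ) ∣ freyA a b := by
      have h1' : (p : ℤ) ∣ 16 * freyA a b := (dvd_pow_self (p : ℤ) two_ne_zero).trans h1
      rcases hp'.dvd_or_dvd h1' with h | h
      · exfalso
        have h16 : (p : ℤ) ∣ (2 : ℤ) ^ 4 := by norm_num; exact h
        exact hp2' (hp'.dvd_of_dvd_pow h16)
      · exact h
    have hpP : (p : ℤ) ∣ ((b : ℤ) - a) * (2 * a + b) * (a + 2 * b) := by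
      have e : (freyPair a b).2 = (-(2 : ℤ) ^ 5) * (((b : ℤ) - a) * (2 * a + b) * (a + 2 * b)) := by
        rw [freyPair_snd]; ring
      rw [e] at h2
      rcases hp'.dvd_or_dvd h2 with h | h
      · exact absurd (hp'.dvd_of_dvd_pow ((dvd_neg).mp h)) hp2'
      · exact h
    exact not_dvd_freyA_of_dvd_P hab hp hp3 hpA hpP

/-- Twisted version at a prime `p ∤ d`, `p` odd: `p² ∣ d²·16A` and `p ∣ d³·c₆` is impossible. -/
theorem odd_prime_not_dvd_twist (hab : Nat.Coprime a b) {p : ℕ} (hp : p.Prime) (hp2 : p ≠ 2)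
    (hpd : ¬ p ∣ d) (h1 : (p : ℤ) ^ 2 ∣ (d : ℤ) ^ 2 * (16 * freyA a b))
    (h2 : (p : ℤ) ∣ (d : ℤ) ^ 3 * (freyPair a b).2) : False := by
  have hp' : Prime (p : ℤ) := Nat.prime_iff_prime_int.mp hp
  have hcop : IsCoprime (p : ℤ) (d : ℤ) :=
    Nat.isCoprime_iff_coprime.mpr ((Nat.Prime.coprime_iff_not_dvd hp).mpr hpd)
  refine odd_prime_sq_dvd_c4_dvd_c6 hab hp hp2 (hcop.pow.dvd_of_dvd_mul_left h1) ?_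
  rcases hp'.dvd_or_dvd h2 with h | h
  · exact absurd (Int.natCast_dvd_natCast.mp (hp'.dvd_of_dvd_pow h)) hpd
  · exact h

/-- Twisted version at the twisting prime itself (`d` an odd prime): `d⁴ ∣ d²·16A` and `d⁴ ∣ d³·c₆`
is impossible. -/
theorem twistPrime_not_dvd (hab : Nat.Coprime a b) (hd : d.Prime) (hd2 : d ≠ 2)
    (h1 : (d : ℤ) ^ 4 ∣ (d : ℤ) ^ 2 * (16 * freyA a b))
    (h2 : (d : ℤ) ^ 4 ∣ (d : ℤ) ^ 3 * (freyPair a b).2) : False := by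
  have hd0 : (d : ℤ) ≠ 0 := by exact_mod_cast hd.ne_zero
  refine odd_prime_sq_dvd_c4_dvd_c6 hab hd hd2 ?_ ?_
  · have e : (d : ℤ) ^ 4 = (d : ℤ) ^ 2 * (d : ℤ) ^ 2 := by ring
    rw [e] at h1
    exact (mul_dvd_mul_iff_left (pow_ne_zero 2 hd0)).mp h1
  · have e : (d : ℤ) ^ 4 = (d : ℤ) ^ 3 * d := by ring
    rw [e] at h2
    exact (mul_dvd_mul_iff_left (pow_ne_zero 3 hd0)).mp h2

/-- `v₂(d²·16A) = 4` for `d` odd (`A` is odd, `two_not_dvd_freyA`): `2^j ∣ d²·16A` forces `j ≤ 4`. -/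
theorem two_pow_dvd_twist_fst (hab : Nat.Coprime a b) (hd2 : ¬ 2 ∣ d) {j : ℕ}
    (h : (2 : ℤ) ^ j ∣ (d : ℤ) ^ 2 * (16 * freyA a b)) : j ≤ 4 := by
  by_contra hj
  have h5 : (2 : ℤ) ^ 5 ∣ (2 : ℤ) ^ j := pow_dvd_pow 2 (by omega)
  have e : (d : ℤ) ^ 2 * (16 * freyA a b) = (2 : ℤ) ^ 4 * ((d : ℤ) ^ 2 * freyA a b) := by ring
  have h2 : (2 : ℤ) ∣ (d : ℤ) ^ 2 * freyA a b := by
    have h32 : (2 : ℤ) ^ 4 * 2 ∣ (2 : ℤ) ^ 4 * ((d : ℤ) ^ 2 * freyA a b) := by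
      rw [← e, ← pow_succ]; exact h5.trans h
    exact (mul_dvd_mul_iff_left (by norm_num)).mp h32
  rcases Int.prime_two.dvd_or_dvd h2 with h | h
  · exact hd2 (by exact_mod_cast Int.prime_two.dvd_of_dvd_pow h)
  · exact two_not_dvd_freyA hab h

/-! ## 2. Tower-freeness and the twist divisors -/

/-- A prime divisor of `d ∈ {1} ∪ primes` is `d` itself, and then `d` is prime. -/
theorem eq_of_prime_dvd_twist (hd : d = 1 ∨ Nat.Prime d) {p : ℕ} (hp : p.Prime) (hpd : p ∣ d) :
    p = d ∧ d.Prime := by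
  rcases hd with rfl | hd
  · exact absurd (Nat.dvd_one.mp hpd) hp.ne_one
  · exact ⟨(Nat.prime_dvd_prime_iff_eq hp hd).mp hpd, hd⟩

/-- **Tower-freeness of the twisted Frey pair** (`gcd(a,b) = 1`, `d` odd, `d = 1` or prime). -/
theorem tf_twist (hcop : Nat.Coprime a b) (hd : d = 1 ∨ Nat.Prime d) (hd2 : ¬ 2 ∣ d) :
    TF ((d : ℤ) ^ 2 * (freyPair a b).1, (d : ℤ) ^ 3 * (freyPair a b).2) := by
  refine ⟨fun p hp h5 h46 => ?_, fun h => ?_, fun h => ?_⟩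
  · obtain ⟨h4, h6⟩ := h46
    have h4' : (p : ℤ) ^ 4 ∣ (d : ℤ) ^ 2 * (16 * freyA a b) := h4
    have h6' : (p : ℤ) ^ 6 ∣ (d : ℤ) ^ 3 * (freyPair a b).2 := h6
    by_cases hpd : p ∣ d
    · obtain ⟨hpdeq, hdp⟩ := eq_of_prime_dvd_twist hd hp hpd
      subst hpdeq
      exact twistPrime_not_dvd hcop hp (by omega) h4' ((pow_dvd_pow _ (by norm_num)).trans h6')
    · exact odd_prime_not_dvd_twist hcop hp (by omega) hpd ((pow_dvd_pow _ (by norm_num)).trans h4')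
        ((dvd_pow_self _ (by norm_num)).trans h6')
  · obtain ⟨h8, -⟩ := h
    have h8' : (2 : ℤ) ^ 8 ∣ (d : ℤ) ^ 2 * (16 * freyA a b) := h8
    have := two_pow_dvd_twist_fst hcop hd2 h8'
    omega
  · obtain ⟨h5, h9⟩ := h
    have h5' : (3 : ℤ) ^ 5 ∣ (d : ℤ) ^ 2 * (16 * freyA a b) := h5
    have h9' : (3 : ℤ) ^ 9 ∣ (d : ℤ) ^ 3 * (freyPair a b).2 := h9
    by_cases h3d : 3 ∣ d
    · obtain ⟨h3eq, hdp⟩ := eq_of_prime_dvd_twist hd Nat.prime_three h3d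
      subst h3eq
      refine twistPrime_not_dvd hcop hdp (by norm_num) ?_ ?_
      · have h := (pow_dvd_pow (3 : ℤ) (by norm_num : 4 ≤ 5)).trans h5'
        exact_mod_cast h
      · have h := (pow_dvd_pow (3 : ℤ) (by norm_num : 4 ≤ 9)).trans h9'
        exact_mod_cast h
    · refine odd_prime_not_dvd_twist hcop Nat.prime_three (by norm_num) h3d ?_ ?_
      · have h := (pow_dvd_pow (3 : ℤ) (by norm_num : 2 ≤ 5)).trans h5'
        exact_mod_cast h
      · have h := (dvd_pow_self (3 : ℤ) (by norm_num : (9 : ℕ) ≠ 0)).trans h9'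
        exact_mod_cast h

/-- **Twist divisors**: `d'² ∣ x.1` and `d'³ ∣ x.2` force `d' ∣ 4d` (prime by prime: `v₂(d') ≤ 2` as
`v₂(x.1) = 4`; an odd `p ≠ d` cannot divide `d'`; `v_d(d') ≤ 1`). -/
theorem twistDiv_dvd (hcop : Nat.Coprime a b) (hd : d = 1 ∨ Nat.Prime d) (hd2 : ¬ 2 ∣ d)
    (hx1 : (d : ℤ) ^ 2 * (freyPair a b).1 ≠ 0) :
    ∀ d' : ℕ, (d' : ℤ) ^ 2 ∣ (d : ℤ) ^ 2 * (freyPair a b).1 →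
      (d' : ℤ) ^ 3 ∣ (d : ℤ) ^ 3 * (freyPair a b).2 → d' ∣ 4 * d := by
  intro d' h2 h3
  have hd0 : d ≠ 0 := fun h => hd2 (h ▸ dvd_zero 2)
  have hd'0 : d' ≠ 0 := by
    rintro rfl
    have e : (((0 : ℕ) : ℤ)) ^ 2 = 0 := by norm_num
    rw [e, zero_dvd_iff] at h2
    exact hx1 h2
  have h4d : 4 * d ≠ 0 := by omega
  refine (Nat.factorization_prime_le_iff_dvd hd'0 h4d).mp fun p hp => ?_
  refine (hp.pow_dvd_iff_le_factorization h4d).mp ?_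
  set k : ℕ := d'.factorization p with hk
  have hpk : p ^ k ∣ d' := Nat.ordProj_dvd d' p
  have hpkZ : (p : ℤ) ^ k ∣ (d' : ℤ) := by exact_mod_cast hpk
  have h2k : (p : ℤ) ^ (2 * k) ∣ (d : ℤ) ^ 2 * (16 * freyA a b) := by
    rw [← freyPair_fst, mul_comm 2 k, pow_mul]
    exact (pow_dvd_pow_of_dvd hpkZ 2).trans h2
  have h3k : (p : ℤ) ^ (3 * k) ∣ (d : ℤ) ^ 3 * (freyPair a b).2 := by
    rw [mul_comm 3 k, pow_mul]
    exact (pow_dvd_pow_of_dvd hpkZ 3).trans h3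
  rcases Nat.eq_zero_or_pos k with hk0 | hkpos
  · rw [hk0, pow_zero]; exact one_dvd _
  by_cases hp2 : p = 2
  · subst hp2
    have hk2 : k ≤ 2 := by
      have h := two_pow_dvd_twist_fst hcop hd2 (j := 2 * k) (by exact_mod_cast h2k)
      omega
    exact (pow_dvd_pow 2 hk2).trans ⟨d, by norm_num⟩
  · by_cases hpd : p ∣ d
    · obtain ⟨hpdeq, hdp⟩ := eq_of_prime_dvd_twist hd hp hpd
      rcases Nat.lt_or_ge k 2 with hk1 | hk2
      · have hk1' : k = 1 := by omega
        rw [hk1', pow_one, hpdeq]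
        exact dvd_mul_left d 4
      · exfalso
        subst hpdeq
        exact twistPrime_not_dvd hcop hp hp2 ((pow_dvd_pow _ (by omega : 4 ≤ 2 * k)).trans h2k)
          ((pow_dvd_pow _ (by omega : 4 ≤ 3 * k)).trans h3k)
    · exact (odd_prime_not_dvd_twist hcop hp hp2 hpd ((pow_dvd_pow _ (by omega : 2 ≤ 2 * k)).trans h2k)
        ((dvd_pow_self _ (by omega : 3 * k ≠ 0)).trans h3k)).elim

/-! ## 3. The conductor proxy and the simple radical -/

/-- `Δ(x) = (x.1³ − x.2²)/1728 = 16·(ab(a+b))²·d⁶` for the twisted pair, as a natural number. -/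
theorem natAbs_twist_delta (a b d : ℕ) :
    ((((d : ℤ) ^ 2 * (freyPair a b).1) ^ 3 - ((d : ℤ) ^ 3 * (freyPair a b).2) ^ 2) / 1728).natAbs
      = 16 * (a * b * (a + b)) ^ 2 * d ^ 6 := by
  have e : ((d : ℤ) ^ 2 * (freyPair a b).1) ^ 3 - ((d : ℤ) ^ 3 * (freyPair a b).2) ^ 2
      = 1728 * ((16 * (a * b * (a + b)) ^ 2 * d ^ 6 : ℕ) : ℤ) := by
    push_cast
    linear_combination (d : ℤ) ^ 6 * freyPair_cube_sub_sq a b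
  rw [e, Int.mul_ediv_cancel_left _ (by norm_num : (1728 : ℤ) ≠ 0), Int.natAbs_natCast]

/-- **`N*(x) ≤ 2·rad(ab(a+b))·d²` for the twisted pair**: the primes of `Δ = 16m²d⁶` are those of `m`
(`2 ∣ m`) together with `d`; an odd prime of `m` does not divide `x.1 = d²·16A` (`d ∤ m`,
`not_dvd_freyA_of_dvd_abc`) and is charged `p`, the prime `2` is charged `≤ 2·2`, and `d` is charged `≤ d²`. -/
theorem nstar_twist_le (ha : 0 < a) (hb : 0 < b) (hcop : Nat.Coprime a b)
    (hd : d = 1 ∨ Nat.Prime d) (hdm : Nat.Coprime d (a * b * (a + b))) :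
    Nstar ((d : ℤ) ^ 2 * (freyPair a b).1, (d : ℤ) ^ 3 * (freyPair a b).2) ≤ 2 * rad a b (a + b) * d ^ 2 := by
  show ∏ p ∈ ((((d : ℤ) ^ 2 * (freyPair a b).1) ^ 3 - ((d : ℤ) ^ 3 * (freyPair a b).2) ^ 2) /
      1728).natAbs.primeFactors, (if ((p : ℕ) : ℤ) ∣ (d : ℤ) ^ 2 * (freyPair a b).1 then p ^ 2 else p)
      ≤ 2 * rad a b (a + b) * d ^ 2
  rw [natAbs_twist_delta]
  set m : ℕ := a * b * (a + b) with hm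
  have hm0 : m ≠ 0 := by positivity
  have hd0 : d ≠ 0 := by
    rcases hd with rfl | hd
    · exact one_ne_zero
    · exact hd.ne_zero
  have hpdm : ∀ p : ℕ, p.Prime → p ∣ d → p ∣ m → False := fun p hpp hpd hpm => by
    have h := Nat.dvd_gcd hpd hpm
    rw [hdm.gcd_eq_one] at h
    exact hpp.ne_one (Nat.dvd_one.mp h)
  have hsub : (16 * m ^ 2 * d ^ 6).primeFactors ⊆ insert d m.primeFactors := by
    intro p hp
    have hpp : p.Prime := Nat.prime_of_mem_primeFactors hp
    have hdvd : p ∣ 16 * m ^ 2 * d ^ 6 := Nat.dvd_of_mem_primeFactors hp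
    rw [Finset.mem_insert]
    rcases (Nat.Prime.dvd_mul hpp).mp hdvd with h | h
    · right
      refine Nat.mem_primeFactors.mpr ⟨hpp, ?_, hm0⟩
      rcases (Nat.Prime.dvd_mul hpp).mp h with h | h
      · rw [eq_two_of_dvd_sixteen hpp h, hm]; exact two_dvd_abc a b
      · exact hpp.dvd_of_dvd_pow h
    · exact Or.inl (eq_of_prime_dvd_twist hd hpp (hpp.dvd_of_dvd_pow h)).1
  have hdnot : d ∉ m.primeFactors := fun h =>
    hpdm d (Nat.prime_of_mem_primeFactors h) dvd_rfl (Nat.dvd_of_mem_primeFactors h)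
  have hle : ∀ p ∈ m.primeFactors,
      (if ((p : ℕ) : ℤ) ∣ (d : ℤ) ^ 2 * (freyPair a b).1 then p ^ 2 else p) ≤ p * (if p = 2 then 2 else 1) := by
    intro p hp
    have hpp : p.Prime := Nat.prime_of_mem_primeFactors hp
    have hpm : p ∣ m := Nat.dvd_of_mem_primeFactors hp
    by_cases hp2 : p = 2
    · subst hp2
      rw [if_pos rfl]
      split_ifs <;> norm_num
    · rw [if_neg hp2, mul_one, if_neg]
      intro hdiv
      have hdiv' : (p : ℤ) ∣ (d : ℤ) ^ 2 * (16 * freyA a b) := hdiv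
      have hp' : Prime (p : ℤ) := Nat.prime_iff_prime_int.mp hpp
      rcases hp'.dvd_or_dvd hdiv' with h | h
      · exact hpdm p hpp (Int.natCast_dvd_natCast.mp (hp'.dvd_of_dvd_pow h)) hpm
      · rcases hp'.dvd_or_dvd h with h | h
        · exact hp2 (eq_two_of_dvd_sixteen hpp (by exact_mod_cast h))
        · refine not_dvd_freyA_of_dvd_abc hcop hpp h ?_
          rw [hm] at hpm
          exact_mod_cast hpm
  calc ∏ p ∈ (16 * m ^ 2 * d ^ 6).primeFactors,
        (if ((p : ℕ) : ℤ) ∣ (d : ℤ) ^ 2 * (freyPair a b).1 then p ^ 2 else p)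
      ≤ ∏ p ∈ insert d m.primeFactors,
          (if ((p : ℕ) : ℤ) ∣ (d : ℤ) ^ 2 * (freyPair a b).1 then p ^ 2 else p) := by
        refine Finset.prod_le_prod_of_subset_of_one_le' hsub fun p hp _ => ?_
        have h1 : 1 ≤ p := by
          rcases Finset.mem_insert.mp hp with h | h
          · rw [h]; exact Nat.one_le_iff_ne_zero.mpr hd0
          · exact (Nat.prime_of_mem_primeFactors h).one_lt.le
        split_ifs
        · exact Nat.one_le_pow _ _ h1
        · exact h1
    _ = (if ((d : ℕ) : ℤ) ∣ (d : ℤ) ^ 2 * (freyPair a b).1 then d ^ 2 else d) *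
          ∏ p ∈ m.primeFactors, (if ((p : ℕ) : ℤ) ∣ (d : ℤ) ^ 2 * (freyPair a b).1 then p ^ 2 else p) :=
        Finset.prod_insert hdnot
    _ ≤ d ^ 2 * ∏ p ∈ m.primeFactors, (p * (if p = 2 then 2 else 1)) := by
        refine Nat.mul_le_mul ?_ (Finset.prod_le_prod' hle)
        split_ifs
        · exact le_rfl
        · exact Nat.le_self_pow two_ne_zero d
    _ = d ^ 2 * ((∏ p ∈ m.primeFactors, p) * ∏ p ∈ m.primeFactors, (if p = 2 then 2 else 1)) := by
        rw [Finset.prod_mul_distrib]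
    _ ≤ d ^ 2 * (rad a b (a + b) * 2) := by
        refine Nat.mul_le_mul le_rfl (Nat.mul_le_mul ?_ ?_)
        · rw [Literature.NumberTheory.DiophantineGeometry.rad_def, Nat.radical_eq_prod_primeFactors, ← hm]
        · rw [Finset.prod_ite_eq']
          split_ifs <;> norm_num
    _ = 2 * rad a b (a + b) * d ^ 2 := by ring

/-- **The simple radical of the twisted pair is `1`**: `x.1³ − x.2² = 2¹⁰·3³·(ab(a+b))²·d⁶`, so every
prime of it divides it at least squared and the filtered product is empty. -/
theorem simpleRad_twist_eq_one (a b d : ℕ) :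
    simpleRad ((d : ℤ) ^ 2 * (freyPair a b).1, (d : ℤ) ^ 3 * (freyPair a b).2) = 1 := by
  show ∏ p ∈ (((d : ℤ) ^ 2 * (freyPair a b).1) ^ 3 - ((d : ℤ) ^ 3 * (freyPair a b).2) ^ 2).natAbs.primeFactors.filter
      (fun p : ℕ => ¬ (((p : ℕ) : ℤ) ^ 2 ∣ ((d : ℤ) ^ 2 * (freyPair a b).1) ^ 3 - ((d : ℤ) ^ 3 * (freyPair a b).2) ^ 2)), p = 1
  have e8 : ((d : ℤ) ^ 2 * (freyPair a b).1) ^ 3 - ((d : ℤ) ^ 3 * (freyPair a b).2) ^ 2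
      = 27648 * ((a : ℤ) * b * (a + b)) ^ 2 * (d : ℤ) ^ 6 := by
    linear_combination (d : ℤ) ^ 6 * freyPair_cube_sub_sq a b
  rw [e8]
  refine Finset.prod_eq_one fun p hp => ?_
  exfalso
  obtain ⟨hpF, hnd⟩ := Finset.mem_filter.mp hp
  apply hnd
  have hpp : p.Prime := Nat.prime_of_mem_primeFactors hpF
  have hdvd : (p : ℤ) ∣ 27648 * ((a : ℤ) * b * (a + b)) ^ 2 * (d : ℤ) ^ 6 :=
    Int.ofNat_dvd_left.mpr (Nat.dvd_of_mem_primeFactors hpF)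
  have hp' : Prime (p : ℤ) := Nat.prime_iff_prime_int.mp hpp
  rcases hp'.dvd_or_dvd hdvd with h | h
  · rcases hp'.dvd_or_dvd h with h | h
    · have h2 : p ∣ 2 ^ 10 * 3 ^ 3 := by norm_num; exact_mod_cast h
      rcases (Nat.Prime.dvd_mul hpp).mp h2 with h | h
      · rw [(Nat.prime_dvd_prime_iff_eq hpp Nat.prime_two).mp (hpp.dvd_of_dvd_pow h)]
        exact Dvd.dvd.mul_right (Dvd.dvd.mul_right (by norm_num) _) _
      · rw [(Nat.prime_dvd_prime_iff_eq hpp Nat.prime_three).mp (hpp.dvd_of_dvd_pow h)]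
        exact Dvd.dvd.mul_right (Dvd.dvd.mul_right (by norm_num) _) _
    · have hpm : (p : ℤ) ∣ (a : ℤ) * b * (a + b) := hp'.dvd_of_dvd_pow h
      exact Dvd.dvd.mul_right (Dvd.dvd.mul_left (pow_dvd_pow_of_dvd hpm 2) _) _
  · have hpd : (p : ℤ) ∣ (d : ℤ) := hp'.dvd_of_dvd_pow h
    exact Dvd.dvd.mul_left ((pow_dvd_pow_of_dvd hpd 2).trans (pow_dvd_pow _ (by norm_num))) _

/-! ## 4. The registered sub-goal -/

/-- Registered sub-goal `twistedFreyPair_facts` of stmt-ABC-1975 (summit calibration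
`deep-regime law ⇒ ABC` of the line `deep-moduli-cusp-dispersion`, piece a1): all invariants of the
twisted Frey pair `x = (d²c₄, d³c₆)` of a coprime pair `(a, b)` of distinct positive integers and a
twisting parameter `d = 1` or a prime `∤ ab(a+b)` — non-vanishing, `1728 ∣ x.1³ − x.2² = 27648(ab(a+b))²d⁶`,
tower-freeness, `N* ≤ 2·rad·d²`, simple radical `1`, the level identities and inequalities, and the
twist divisors `d' ∣ 4d`. -/
theorem twistedFreyPair_facts : ∀ a b d : ℕ, 0 < a → 0 < b → a ≠ b → Nat.Coprime a b → (d = 1 ∨ Nat.Prime d) → Nat.Coprime d (a * b * (a + b)) → ∀ x : ℤ × ℤ, x = ((d : ℤ) ^ 2 * (freyPair a b).1, (d : ℤ) ^ 3 * (freyPair a b).2) → x.1 ≠ 0 ∧ x.2 ≠ 0 ∧ x.1 ^ 3 ≠ x.2 ^ 2 ∧ (1728 : ℤ) ∣ x.1 ^ 3 - x.2 ^ 2 ∧ TF x ∧ Nstar x ≤ 2 * Literature.NumberTheory.DiophantineGeometry.rad a b (a + b) * d ^ 2 ∧ simpleRad x = 1 ∧ x.1 ^ 3 - x.2 ^ 2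 = 27648 * ((a : ℤ) * b * (a + b)) ^ 2 * (d : ℤ) ^ 6 ∧ 0 < x.1 ∧ x.1 ^ 3 = (16 * ((a : ℤ) ^ 2 + a * b + (b : ℤ) ^ 2)) ^ 3 * (d : ℤ) ^ 6 ∧ 1728 * ((a : ℤ) + b) ^ 6 ≤ (16 * ((a : ℤ) ^ 2 + a * b + (b : ℤ) ^ 2)) ^ 3 ∧ (16 * ((a : ℤ) ^ 2 + a * b + (b : ℤ) ^ 2)) ^ 3 < 4096 * ((a : ℤ) + b) ^ 6 ∧ 16 * ((a : ℤ) * b * (a + b)) ^ 2 ≤ (16 * ((a : ℤ) ^ 2 + a * b + (b : ℤ) ^ 2)) ^ 3 ∧ (∀ d' : ℕ, (d' : ℤ) ^ 2 ∣ x.1 → (d' : ℤ) ^ 3 ∣ x.2 → d' ∣ 4 * d) := by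
  intro a b d ha hb hab hcop hd hdm x hx
  subst hx
  have hd0 : d ≠ 0 := by
    rcases hd with rfl | hd
    · exact one_ne_zero
    · exact hd.ne_zero
  have hd2 : ¬ 2 ∣ d := by
    intro h2
    have h := Nat.dvd_gcd h2 (two_dvd_abc a b)
    rw [hdm.gcd_eq_one] at h
    omega
  have hdZ : (0 : ℤ) < d := by exact_mod_cast Nat.pos_of_ne_zero hd0
  have haZ : (1 : ℤ) ≤ a := by exact_mod_cast ha
  have hbZ : (1 : ℤ) ≤ b := by exact_mod_cast hb
  have hA : 0 < freyA a b := by unfold freyA; positivity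
  have h9 : (0 : ℤ) < (d : ℤ) ^ 2 * (freyPair a b).1 := by rw [freyPair_fst]; positivity
  have h8 : ((d : ℤ) ^ 2 * (freyPair a b).1) ^ 3 - ((d : ℤ) ^ 3 * (freyPair a b).2) ^ 2
      = 27648 * ((a : ℤ) * b * (a + b)) ^ 2 * (d : ℤ) ^ 6 := by
    linear_combination (d : ℤ) ^ 6 * freyPair_cube_sub_sq a b
  have hMpos : (0 : ℤ) < 27648 * ((a : ℤ) * b * (a + b)) ^ 2 * (d : ℤ) ^ 6 := by positivity
  refine ⟨h9.ne', ?_, ?_, ?_, tf_twist hcop hd hd2, nstar_twist_le ha hb hcop hd hdm,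
    simpleRad_twist_eq_one a b d, h8, h9, ?_, ?_, ?_, ?_, twistDiv_dvd hcop hd hd2 h9.ne'⟩
  · -- `x.2 ≠ 0`
    show (d : ℤ) ^ 3 * (freyPair a b).2 ≠ 0
    rw [freyPair_snd]
    have h1 : (b : ℤ) - a ≠ 0 := sub_ne_zero.mpr (by exact_mod_cast hab.symm)
    have h2 : (2 * (a : ℤ) + b) ≠ 0 := by positivity
    have h3 : ((a : ℤ) + 2 * b) ≠ 0 := by positivity
    exact mul_ne_zero (pow_ne_zero 3 hdZ.ne')
      (mul_ne_zero (mul_ne_zero (mul_ne_zero (by norm_num) h1) h2) h3)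
  · -- `x.1³ ≠ x.2²`
    show ((d : ℤ) ^ 2 * (freyPair a b).1) ^ 3 ≠ ((d : ℤ) ^ 3 * (freyPair a b).2) ^ 2
    intro h
    rw [h, sub_self] at h8
    linarith
  · -- `1728 ∣ x.1³ − x.2²`
    show (1728 : ℤ) ∣ ((d : ℤ) ^ 2 * (freyPair a b).1) ^ 3 - ((d : ℤ) ^ 3 * (freyPair a b).2) ^ 2
    exact ⟨16 * ((a : ℤ) * b * (a + b)) ^ 2 * (d : ℤ) ^ 6, by rw [h8]; ring⟩
  · -- `x.1³ = (16A)³·d⁶`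
    show ((d : ℤ) ^ 2 * (freyPair a b).1) ^ 3 = (16 * ((a : ℤ) ^ 2 + a * b + (b : ℤ) ^ 2)) ^ 3 * (d : ℤ) ^ 6
    rw [freyPair_fst]
    unfold freyA
    ring
  · -- `1728c⁶ ≤ (16A)³` from `12c² ≤ 16A`
    have hlow : 12 * ((a : ℤ) + b) ^ 2 ≤ 16 * ((a : ℤ) ^ 2 + a * b + (b : ℤ) ^ 2) := by
      nlinarith [sq_nonneg ((a : ℤ) - b)]
    have h3 := pow_le_pow_left₀ (by positivity) hlow 3
    calc 1728 * ((a : ℤ) + b) ^ 6 = (12 * ((a : ℤ) + b) ^ 2) ^ 3 := by ring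
      _ ≤ _ := h3
  · -- `(16A)³ < 4096c⁶` from `A < c²`
    have hup : 16 * ((a : ℤ) ^ 2 + a * b + (b : ℤ) ^ 2) < 16 * ((a : ℤ) + b) ^ 2 := by
      nlinarith [mul_pos (by linarith : (0 : ℤ) < a) (by linarith : (0 : ℤ) < b)]
    have h3 := pow_lt_pow_left₀ hup (by positivity) three_ne_zero
    calc (16 * ((a : ℤ) ^ 2 + a * b + (b : ℤ) ^ 2)) ^ 3 < (16 * ((a : ℤ) + b) ^ 2) ^ 3 := h3
      _ = 4096 * ((a : ℤ) + b) ^ 6 := by ring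
  · -- `16m² ≤ (16A)³` from the syzygy `4A³ = P² + 27m²`
    have e : 4 * ((a : ℤ) ^ 2 + a * b + (b : ℤ) ^ 2) ^ 3 =
        (((b : ℤ) - a) * (2 * a + b) * (a + 2 * b)) ^ 2 + 27 * ((a : ℤ) * b * (a + b)) ^ 2 := by ring
    nlinarith [sq_nonneg (((b : ℤ) - a) * (2 * a + b) * (a + 2 * b)), sq_nonneg ((a : ℤ) * b * (a + b))]

end Summit.ABC.ABC.Theorems.SharpModerateLaw.CuspDispersion

end
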